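import Literature.NumberTheory.CubicFields.FundCubicFieldCountShintaniInput
import Literature.NumberTheory.CubicFields.DualDensityPsiSum
import Literature.NumberTheory.CubicFields.PsiFourierMajorant
import Literature.NumberTheory.CubicFields.ShintaniDivResidues
import HarnessLib

/-!
# BTT (3) and Theorem 1.2 from Theorem 2.4 and Theorem 3.2 alone (Proposition 5.1 proved)

Topic `Literature/NumberTheory/CubicFields`; the capstone over `FundCubicFieldCountShintaniInput.lean`
(`btt_fundCubicFieldCount_sum_of_thm24_thm32_prop51`: BTT (3) from Thm 2.4 for the `Ψ_{q²}` (`HasPsiResidues`), Thm 3.2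
(`LandauAverageBound`), Prop. 5.1 (`DualDensityPsiBound`) and Prop. 4.5 (`btt_uniformity_sqDvd`)),
`DualDensityPsiSum.lean` (Prop. 5.1 from Prop. 4.5, a large-height divisibility count `DivCountBound` and the Fourier
majorants of Prop. 5.2), `PsiFourierMajorant.lean` (Prop. 5.2, proved) and `ShintaniDivResidues.lean` (the divisibility
count from Thm 3.2 and Thm 2.4 for the `Φ_{d,m} = 𝟙_{m²d∣Disc}`, `HasDivResidues`). Everything here is PROVED.

Bhargava–Taniguchi–Thorne 2023, §5: the direct proof of (3) `Σ_{0<±D<X} #Cl(ℚ(√D))[3]`-type sums — here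
`Σ_{D ∈ negFundDiscrs X} N₃(D) = (3/(2π²)) X + K⁻ X^{5/6} + O_ε(X^{2/3+ε})` and its positive counterpart
(`btt_fundCubicFieldCount_sum`) — imports from outside the paper's §§4–5 exactly Theorem 2.4 (Sato–Shintani,
Taniguchi–Thorne: continuation and residues of `ξ^±(s, Φ_m)`) and Theorem 3.2 (the uniform Landau-type estimate with
the Chandrasekharan–Narasimhan method); Propositions 5.1 and 5.2 are proved in §5, Prop. 4.5 in §4. With this file
the tree's proof of (3) has the same shape: **hypotheses = Theorem 2.4 (for the two families of test functions
actually used: `Ψ_{q²}` and `𝟙_{m²d∣Disc}`) + Theorem 3.2 + Prop. 4.5** (`btt_uniformity_sqDvd`, a separate named fact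
of the tree), everything else proved:

* `dualDensityPsiBound_of_thm24div_thm32` — Proposition 5.1 (`∀ ε > 0, ∃ C, DualDensityPsiBound ε C`);
* **`btt_fundCubicFieldCount_sum_of_thm24_thm32`** — BTT (3);
* `btt_threeTorsion_sum_of_thm24_thm32` — BTT Theorem 1.2, given in addition the class-field-theory dictionary
  `#Cl(ℚ(√D))[3] = 2N₃(D) + 1`.

## References

* M. Bhargava, T. Taniguchi, F. Thorne, *Improved error estimates for the Davenport–Heilbronn theorems*,
  Math. Ann. 389 (2024) = arXiv:2107.12819, Thm 1.2, (3), Thm 2.4, Thm 3.2, Props. 4.5, 5.1, 5.2, §5 [BhargavaTaniguchiThorne2023].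
-/

noncomputable section

namespace Literature.NumberTheory.CubicFields

open BinaryCubic

/-- **Proposition 5.1** (`Σ_{q∈[Q,2Q]} δ̂₁(q) ≪_ε Q^{2+ε}`) from Prop. 4.5, Theorem 3.2 and Theorem 2.4 for the
`𝟙_{m²d∣Disc}` — Prop. 5.2 and the orbit counting being proved (`PsiFourierMajorant`, `DualDensityPsiSum`,
`ShintaniDivResidues`). [cite: BhargavaTaniguchiThorne2023, Proposition 5.1] -/
theorem dualDensityPsiBound_of_thm24div_thm32 (hU : btt_uniformity_sqDvd)
    (h32 : ∀ c₁₆ c₁₉ cL cU : ℝ, 0 < c₁₆ → 0 < c₁₉ → 0 < cL → cL ≤ cU → ∃ C : ℝ, LandauAverageBound c₁₆ c₁₉ cL cU C)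
    (h24div : ∀ d m : ℕ, Squarefree d → Squarefree m → d.Coprime m → (d * m).Coprime 6 →
      ∀ sgn : ℤ, (sgn = 1 ∨ sgn = -1) → HasDivResidues d m sgn) :
    ∀ ε : ℝ, 0 < ε → ∃ C : ℝ, DualDensityPsiBound ε C := by
  intro ε hε
  obtain ⟨C_B, K_B, hC, hK, hLT⟩ := divCountBound_of_landau hU h32 h24div
  exact dualDensityPsiBound_of_divCountBound hU hC hK hLT (fun q hq f => norm_dualWeight_psiMod_le hq f) hε

/-- **BTT (3) = `btt_fundCubicFieldCount_sum` from Theorem 2.4 (`h24` for the `Ψ_{q²}`, `h24div` for the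
`𝟙_{m²d∣Disc}`), Theorem 3.2 (`h32`) and Proposition 4.5 (`btt_uniformity_sqDvd`)** — Propositions 5.1 and 5.2 of the
source now being theorems of the tree. [cite: BhargavaTaniguchiThorne2023, Section 5 (direct proof of (3))] -/
theorem btt_fundCubicFieldCount_sum_of_thm24_thm32
    (h24 : ∀ q : ℕ, Squarefree q → ∀ sgn : ℤ, (sgn = 1 ∨ sgn = -1) → HasPsiResidues q sgn)
    (h24div : ∀ d m : ℕ, Squarefree d → Squarefree m → d.Coprime m → (d * m).Coprime 6 →
      ∀ sgn : ℤ, (sgn = 1 ∨ sgn = -1) → HasDivResidues d m sgn)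
    (h32 : ∀ c₁₆ c₁₉ cL cU : ℝ, 0 < c₁₆ → 0 < c₁₉ → 0 < cL → cL ≤ cU → ∃ C : ℝ, LandauAverageBound c₁₆ c₁₉ cL cU C)
    (hU : btt_uniformity_sqDvd) : btt_fundCubicFieldCount_sum :=
  btt_fundCubicFieldCount_sum_of_thm24_thm32_prop51 h24 h32 (dualDensityPsiBound_of_thm24div_thm32 hU h32 h24div) hU

/-- … and BTT Theorem 1.2 (`btt_threeTorsion_sum`) with, in addition, the class-field-theory dictionary
`#Cl(ℚ(√D))[3] = 2 N₃(D) + 1`. [cite: BhargavaTaniguchiThorne2023, §5 ((3) ⟺ Thm 1.2)] -/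
theorem btt_threeTorsion_sum_of_thm24_thm32
    (hdict : threeTorsion_eq_two_mul_cubicFieldCountOfDisc_add_one)
    (h24 : ∀ q : ℕ, Squarefree q → ∀ sgn : ℤ, (sgn = 1 ∨ sgn = -1) → HasPsiResidues q sgn)
    (h24div : ∀ d m : ℕ, Squarefree d → Squarefree m → d.Coprime m → (d * m).Coprime 6 →
      ∀ sgn : ℤ, (sgn = 1 ∨ sgn = -1) → HasDivResidues d m sgn)
    (h32 : ∀ c₁₆ c₁₉ cL cU : ℝ, 0 < c₁₆ → 0 < c₁₉ → 0 < cL → cL ≤ cU → ∃ C : ℝ, LandauAverageBound c₁₆ c₁₉ cL cU C)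
    (hU : btt_uniformity_sqDvd) : Literature.NumberTheory.QuadraticFields.btt_threeTorsion_sum :=
  btt_threeTorsion_sum_of_thm24_thm32_prop51 hdict h24 h32 (dualDensityPsiBound_of_thm24div_thm32 hU h32 h24div) hU

end Literature.NumberTheory.CubicFields

end
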